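import Literature.Computability.Complexity.TimeHierarchyProofs
import Literature.Computability.Complexity.KannanLanguage
import Literature.Computability.Complexity.StackBricksStrings
import Literature.Computability.Complexity.FPStringBricks
import Literature.Computability.Complexity.StackWordArith
import Literature.Computability.Complexity.NSubexp
import HarnessLib

/-!
# The diagonal language of the time hierarchy is hard at EVERY large length; `2^{cn}` is time constructible

Companion to `TimeHierarchyDiagonal.lean` / `TimeHierarchyProofs.lean` (the deterministic time
hierarchy theorem over a fuelled universal decider, `FuelledSimulator.diagLang_not_mem_DTIME`: the
diagonal language of `U` is not in `DTIME T`). The diagonal argument printed there (Arora–Barak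
2009, proof of Thm. 3.1: a `DTIME T` decider `M` is refuted on its own padded header `⟨e_M, 0ᴺ⟩` as
soon as `N` is large) refutes `M` at every large LENGTH, since the padded headers have all lengths
`≥ 2|e_M| + 2`. This "almost-everywhere" form is what diagonalization arguments against
infinitely-often simulations consume (e.g. Buhrman–Fortnow–Pavan 2005, proof of Thm. 3.1: "a set `A`
in `DTIME(2^{dn})` such that for every Turing machine `M` using time bounded by `2^{(d-1)n}`, and for
all but a finite number of `n`, `M` fails to compute `A` correctly on some input of length `n`. One
can construct such an `A` by simple diagonalization"). This file PROVES it: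

* `FuelledSimulator.diagLang_eventually_disagree` — for `T, U ≥ id` with `T²/U → 0` and every
  `B ∈ DTIME T`, for all large `n` some word of length `n` lies in exactly one of `B` and the diagonal
  language of `U`;
* `isTimeConstructible_two_pow_mul` — `2^{cn}` (`1 ≤ c`) is time constructible (Arora–Barak 2009,
  §1.3: `2ⁿ` is; here through the `FP` numeral `1ⁿ ↦ 0^{cn} 1`);
* `tendsto_sq_two_pow_mul_div` — `(2^{en})² / 2^{(2e+1)n} → 0`;
* **`exists_ae_hard_mem_E`** — for every `e` there is `A ∈ E` (namely the diagonal language of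
  `U = 2^{(2e'+1)n}`, `e' = max e 1`, over the tree's interpreter `UDet.interp`) such that every
  `B ∈ DTIME(2^{en})` differs from `A` on some word of EVERY large length.

## References

* S. Arora, B. Barak, *Computational Complexity: A Modern Approach*, CUP 2009, Thm. 3.1 (proof),
  Thm. 1.9, §1.4.1, §1.3 (p. 16, time-constructible functions) [AroraBarakCC2009].
* J. Hartmanis, R. E. Stearns, *On the computational complexity of algorithms*, Trans. AMS 117
  (1965), Thm. 9 [HartmanisStearns1965].
* H. Buhrman, L. Fortnow, A. Pavan, *Some results on derandomization*, Theory Comput. Syst. 38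
  (2005), proof of Thm. 3.1 (the consumer) [BuhrmanFortnowPavan2004].
-/

noncomputable section

namespace Literature.Computability.Complexity

open _root_.Computability Turing Filter Topology Polynomial Brick

/-! ### `2^{cn}` is time constructible -/

/-- **`2^{cn}` is time constructible** for `1 ≤ c` (Arora–Barak 2009, §1.3, p. 16: `2ⁿ` is among
the standard examples): `n ≤ 2^{cn}`, and `1ⁿ ↦ bin 2^{cn} = 0^{cn} 1` is an `FP` map (zeros of the
`c`-fold unary word, then a `1`), whose polynomial running time is `≤ K · 2^{cn} + K`.
[cite: AroraBarakCC2009, §1.3 (p. 16)] -/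
theorem isTimeConstructible_two_pow_mul {c : ℕ} (hc : 1 ≤ c) :
    IsTimeConstructible fun n => 2 ^ (c * n) := by
  have hpow : ∀ n, 2 ^ n ≤ 2 ^ (c * n) := fun n =>
    Nat.pow_le_pow_right Nat.two_pos (Nat.le_mul_of_pos_left n hc)
  refine ⟨fun n => Nat.lt_two_pow_self.le.trans (hpow n), ?_⟩
  have hF : (fun w : List Bool => Kannan.zerosFn (onesMulFn c w) ++ [true]) ∈ FP :=
    append_mem_FP (comp_mem_FP Kannan.zerosFn_mem_FP (onesMulFn_mem_FP c)) (const_mem_FP [true])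
  have hP : PolyTimeComputable unaryEncodeNat encodeNat fun n : ℕ => 2 ^ (c * n) := by
    refine hF.of_encode (g := unaryEncodeNat) (fun _ => rfl) fun n => ?_
    show Kannan.zerosFn (onesMulFn c (unaryEncodeNat n)) ++ [true] = encodeNat (2 ^ (c * n))
    rw [Com.encodeNat_two_pow, Kannan.zerosFn_apply, onesMulFn, List.length_replicate,
      show (unaryEncodeNat n).length = n from unary_decode_encode_nat n]
  obtain ⟨p, M, hM⟩ := hP
  obtain ⟨b, hb⟩ := TimeConstructible.exists_poly_le_two_pow_pow p le_rfl
  refine ⟨b, M, fun n => (hM n).mono ?_⟩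
  have hl : (unaryEncodeNat n).length = n := unary_decode_encode_nat n
  show p.eval (unaryEncodeNat n).length ≤ b * 2 ^ (c * (unaryEncodeNat n).length) + b
  rw [hl]
  have h := hb n
  rw [pow_one] at h
  exact h.trans (Nat.add_le_add_right (Nat.mul_le_mul_left b (hpow n)) b)

/-! ### The diagonal language disagrees with every `DTIME T` language at every large length -/

namespace FuelledSimulator

variable (𝒮 : FuelledSimulator)

/-- **The diagonal step, almost everywhere.** If `T n ≥ n`, `U n ≥ n` and `T² / U → 0`, then for
every `B ∈ DTIME T` and all large `n` there is a word `x` of length `n` with `x ∈ B ↔ x ∉ diagLang U`: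
for a decider `M` of `B` in time `cT + c` with header `e_M`, the padded header `x = ⟨e_M, 0^{n-2|e_M|-2}⟩`
has length `n`, and the simulator answers `¬ M(x) = ¬ 𝟙_B(x)` on it within the fuel `U(n)`.
[cite: AroraBarakCC2009, Thm. 3.1 (proof)] -/
theorem diagLang_eventually_disagree {T U : ℕ → ℕ} (hT : ∀ n, n ≤ T n) (hU : ∀ n, n ≤ U n)
    (h : Tendsto (fun n => (T n : ℝ) ^ 2 / U n) atTop (𝓝 0)) {B : Language Bool}
    (hB : B ∈ DTIME T) :
    ∃ n₀ : ℕ, ∀ n ≥ n₀, ∃ x : List Bool, x.length = n ∧ (x ∈ B ↔ x ∉ 𝒮.diagLang U) := by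
  obtain ⟨c, M, hM⟩ := hB
  obtain ⟨e, κ, he⟩ := 𝒮.universal M
  obtain ⟨N, hN⟩ := eventually_mul_sq_add_le_of_tendsto_sq_div hU h (κ * (2 * c + 2) ^ 2)
  refine ⟨2 * e.length + 2 + N, fun n hn => ?_⟩
  refine ⟨boolPair e (List.replicate (n - (2 * e.length + 2)) false), ?_, ?_⟩
  · rw [length_boolPair, List.length_replicate]; omega
  · have hlen : N ≤ (boolPair e (List.replicate (n - (2 * e.length + 2)) false)).length := by
      rw [length_boolPair, List.length_replicate]; omega
    -- the decider's run on the padded header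
    have hrun : M.OutputsWithin (boolPair e (List.replicate (n - (2 * e.length + 2)) false))
        (encodeBool (B.boolIndicator (boolPair e (List.replicate (n - (2 * e.length + 2)) false))))
        (c * T (boolPair e (List.replicate (n - (2 * e.length + 2)) false)).length + c) :=
      hM _
    -- the fuel suffices
    have hroom : κ * (c * T (boolPair e (List.replicate (n - (2 * e.length + 2)) false)).length + c +
        (boolPair e (List.replicate (n - (2 * e.length + 2)) false)).length) ^ 2 + κ ≤
        U (boolPair e (List.replicate (n - (2 * e.length + 2)) false)).length := by
      generalize hm : (boolPair e (List.replicate (n - (2 * e.length + 2)) false)).length = m at hlen ⊢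
      have hTm : m ≤ T m := hT m
      have hm1 : 1 ≤ m := by rw [← hm, length_boolPair]; omega
      have hT1 : c ≤ c * T m := by
        simpa using Nat.mul_le_mul_left c (le_trans hm1 hTm)
      have h1 : c * T m + c + m ≤ (2 * c + 2) * T m := by nlinarith
      have h2 : κ * (c * T m + c + m) ^ 2 ≤ κ * (2 * c + 2) ^ 2 * T m ^ 2 := by
        have := Nat.pow_le_pow_left h1 2
        calc κ * (c * T m + c + m) ^ 2 ≤ κ * ((2 * c + 2) * T m) ^ 2 := Nat.mul_le_mul_left κ this
          _ = κ * (2 * c + 2) ^ 2 * T m ^ 2 := by ring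
      have h3 : κ ≤ κ * (2 * c + 2) ^ 2 := by
        have : 1 ≤ (2 * c + 2) ^ 2 := Nat.one_le_pow _ _ (by omega)
        nlinarith
      have h4 := hN m hlen
      omega
    -- the simulator flips the decider's answer
    have hflip := he _ _ _ _ hrun hroom
    rw [mem_diagLang_iff, hflip]
    cases hb : B.boolIndicator (boolPair e (List.replicate (n - (2 * e.length + 2)) false))
    · have hx : boolPair e (List.replicate (n - (2 * e.length + 2)) false) ∉ B :=
        (Set.notMem_iff_boolIndicator _ _).2 hb
      simp [hx]
    · have hx : boolPair e (List.replicate (n - (2 * e.length + 2)) false) ∈ B :=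
        (Set.mem_iff_boolIndicator _ _).2 hb
      simp [hx]

end FuelledSimulator

/-! ### The almost-everywhere-hard language in `E` -/

/-- `(2^{en})² / 2^{(2e+1)n} = (1/2)ⁿ → 0`. [folklore] -/
theorem tendsto_sq_two_pow_mul_div (e : ℕ) :
    Tendsto (fun n => (((2 ^ (e * n) : ℕ) : ℕ) : ℝ) ^ 2 / ((2 ^ ((2 * e + 1) * n) : ℕ) : ℕ)) atTop (𝓝 0) := by
  have h : (fun n => (((2 ^ (e * n) : ℕ) : ℕ) : ℝ) ^ 2 / ((2 ^ ((2 * e + 1) * n) : ℕ) : ℕ)) =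
      fun n => ((1 : ℝ) / 2) ^ n := by
    funext n
    push_cast
    have h1 : ((2 : ℝ) ^ (e * n)) ^ 2 = 2 ^ (2 * e * n) := by rw [← pow_mul]; ring_nf
    have h2 : (2 : ℝ) ^ ((2 * e + 1) * n) = 2 ^ (2 * e * n) * 2 ^ n := by rw [← pow_add]; ring_nf
    rw [h1, h2, one_div_pow, div_mul_eq_div_div, div_self (by positivity)]
  rw [h]
  exact tendsto_pow_atTop_nhds_zero_of_lt_one (by norm_num) (by norm_num)

/-- **An almost-everywhere-hard language in `E`**: for every `e` there is `A ∈ E` such that every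
`B ∈ DTIME(2^{en})` differs from `A` on some word of every large length — the diagonal language of
`U = 2^{(2e'+1)n}`, `e' = max e 1`, over the tree's fuelled interpreter (`FuelledRun.fuelledSimulator
UDet.interp`, `TimeHierarchyProofs.lean`). (Buhrman–Fortnow–Pavan 2005, proof of Thm. 3.1: "One can
construct such an `A` by simple diagonalization.") [cite: AroraBarakCC2009, Thm. 3.1 (proof)]
[cite: BuhrmanFortnowPavan2004, Thm. 3.1 (proof)] -/
theorem exists_ae_hard_mem_E (e : ℕ) : ∃ A ∈ E, ∀ B ∈ DTIME (fun n => 2 ^ (e * n)),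
    ∃ n₀ : ℕ, ∀ n ≥ n₀, ∃ x : List Bool, x.length = n ∧ (x ∈ B ↔ x ∉ A) := by
  let 𝒮 : FuelledSimulator := FuelledRun.fuelledSimulator UDet.interp UDet.DR.X UDet.DR.ans UDet.interprets
  set e' := max e 1 with he'
  have he1 : 1 ≤ e' := le_max_right _ _
  have hU := isTimeConstructible_two_pow_mul (c := (2 * e' + 1)) (by omega)
  have hT := isTimeConstructible_two_pow_mul he1
  refine ⟨𝒮.diagLang fun n => 2 ^ ((2 * e' + 1) * n), ?_, fun B hB => ?_⟩
  · exact Set.mem_iUnion.2 ⟨2 * e' + 1, 𝒮.diagLang_mem_DTIME hU⟩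
  · -- `DTIME(2^{en}) ⊆ DTIME(2^{e'n})`
    have hB' : B ∈ DTIME fun n => 2 ^ (e' * n) := by
      obtain ⟨a, ha⟩ := hB
      refine ⟨a, timeClass_mono (fun n => ?_) ha⟩
      have : 2 ^ (e * n) ≤ 2 ^ (e' * n) :=
        Nat.pow_le_pow_right Nat.two_pos (Nat.mul_le_mul_right n (le_max_left e 1))
      exact Nat.add_le_add_right (Nat.mul_le_mul_left a this) a
    exact 𝒮.diagLang_eventually_disagree hT.1 hU.1 (tendsto_sq_two_pow_mul_div e') hB'

end Literature.Computability.Complexity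

end
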